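import Mathlib.GroupTheory.Nilpotent
import Summits.Langlands.Langlands.Theorems.IrreducibilityBySelfDualityIrreducibleOffSectorArtinType
import Literature.NumberTheory.Automorphic.StrongArtinGL2
import Literature.NumberTheory.Automorphic.GLnAdelicStructureProofs
import Literature.NumberTheory.GaloisRepresentations.ArtinRestriction
import Literature.NumberTheory.GaloisRepresentations.ArtinReciprocityCharacterProofs
import Literature.NumberTheory.PAdicHodge.FontaineDpst
import Literature.FieldTheory.AlgClosed.PadicAlgClEquivComplex
import HarnessLib

/-!
# F4 ON-PATH lemma for the line `FittingIndexTwoReciprocity` (crux `ReciprocityUpToIrreducibility`,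
# item stmt-Langlands-14328; forward generator G4 ladder-down, generation 21)

Sorry-free: `Langlands → FittingIndexReciprocity d` for every `d`, in particular the RUNG
`Langlands → FittingIndexTwoReciprocity`.

Light-import edition (Statement-level, like the g19/g20 on-path files): the tree theorem
`Summit.Langlands.Langlands.Theorems.strongArtin_of_langlands` (file
`Theorems/ParityBlindBianchiEvenArtinJunctionSummitImpliesTarget.lean`) is re-derived here verbatim from its
Statement-level ingredients, so that this workfile does not import `Theses.IrreducibilityBySelfDuality` /
`Theses.ParityBlindBianchi`:
* the `ℓ`-adic dual transport `ρ₀ = ι⁻¹(σ⁻ᵀ)` of an Artin representation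
  (`IrreducibleOffSector.exists_lAdicDualTransport`, imported);
* open kernel ⇒ geometric for every reciprocity datum (`isGeometricFramed_of_isOpen_ker_onPath`: unramified
  a.e. by `FramedGaloisRep.eventually_isUnramifiedAt_of_isOpen_ker`, de Rham above `ℓ` by
  `fontainePstAdicCompletion_isDeRhamFramed_of_finite_range` — private copies of c8's
  `finite_range_toLocal_of_isOpen_ker` / `isGeometricFramed_of_isOpen_ker'`);
* the inverse Satake dictionary for the dual transport (private copies of
  `hasFrobCharpolyAt_satakePolynomial_of_lAdicDualTransport`,
  `isPiOfArtinRep_of_eventually_satakeFrobCompatibleAt_lAdicDualTransport`).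
Landing target (if the operator wants it in `Theorems/`):
`Summits/Langlands/Langlands/Theorems/FittingIndexTwoReciprocityOnPath.lean`.
-/

noncomputable section

set_option linter.dupNamespace false

open scoped MatrixGroups Matrix NumberField Classical Polynomial
open Filter IsDedekindDomain Field NumberField Polynomial
open Literature.NumberTheory.Automorphic Literature.NumberTheory.GaloisRepresentations
open Summit.Langlands Summit.Langlands.Langlands.Theorems

namespace Summit.Langlands.Langlands.Cruxes.ReciprocityUpToIrreducibility.FittingIndexTwoReciprocity.OnPath

/-! ## 0. Statement-level support (private copies of tree lemmas whose home files import the heavy Theses) -/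

section Support

variable {K : Type} [Field K] [NumberField K] {n : ℕ} {ℓ : ℕ} [Fact ℓ.Prime]

/-- Open kernel ⇒ finite image (`Γ_K` compact, `CharZero K`). [cite: SerreAbelianLadic1968, Ch. III §2.3] -/
private theorem finite_range_of_isOpen_ker_onPath {A : Type*} [CommRing A] [TopologicalSpace A]
    {m : ℕ} (ρ : FramedGaloisRep K A m)
    (hker : IsOpen (ρ.toMonoidHom.ker : Set (absoluteGaloisGroup K))) :
    (Set.range ρ).Finite := by
  haveI : Finite (absoluteGaloisGroup K ⧸ ρ.toMonoidHom.ker) :=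
    Subgroup.quotient_finite_of_isOpen _ hker
  haveI : Finite ρ.toMonoidHom.range :=
    Finite.of_equiv _ (QuotientGroup.quotientKerEquivRange ρ.toMonoidHom).toEquiv
  have h : ((ρ.toMonoidHom.range : Subgroup (GL (Fin m) A)) : Set (GL (Fin m) A)).Finite :=
    Set.toFinite _
  rwa [MonoidHom.coe_range] at h

/-- Open kernel ⇒ finite image on every decomposition group. [cite: SerreAbelianLadic1968, Ch. III §2.3] -/
private theorem finite_range_toLocal_of_isOpen_ker_onPath {A : Type*} [CommRing A]
    [TopologicalSpace A] {m : ℕ} (ρ : FramedGaloisRep K A m)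
    (hker : IsOpen (ρ.toMonoidHom.ker : Set (absoluteGaloisGroup K)))
    (v : HeightOneSpectrum (𝓞 K)) : (Set.range (ρ.toLocal v)).Finite :=
  (finite_range_of_isOpen_ker_onPath ρ hker).subset <| by
    rintro _ ⟨τ, rfl⟩
    exact ⟨absGaloisRestrict K (v.adicCompletion K) τ, (FramedGaloisRep.toLocal_apply v ρ τ).symm⟩

/-- **Open-kernel (Artin-type) representations are geometric for every reciprocity datum, every rank,
unconditionally** (copy of c8's `isGeometricFramed_of_isOpen_ker'`): unramified a.e.
(`FramedGaloisRep.eventually_isUnramifiedAt_of_isOpen_ker`) and de Rham at every `v ∣ ℓ` for THE pinned datum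
`𝓡.pst ℓ v hv = fontainePstAdicCompletion v ℓ hv` (`fontainePstAdicCompletion_isDeRhamFramed_of_finite_range`).
[cite: FontaineMazurGeometric1995, §1] [cite: FontaineAsterisque223III, Exp. III §3] -/
theorem isGeometricFramed_of_isOpen_ker_onPath {m : ℕ} (Rec : ReciprocityData K)
    (ρ : FramedGaloisRep K (PadicAlgCl ℓ) m)
    (hker : IsOpen (ρ.toMonoidHom.ker : Set (absoluteGaloisGroup K))) : IsGeometricFramed Rec ρ :=
  ⟨ρ.eventually_isUnramifiedAt_of_isOpen_ker hker, fun v hv =>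
    Literature.NumberTheory.PAdicHodge.fontainePstAdicCompletion_isDeRhamFramed_of_finite_range v ℓ hv
      (ρ.toLocal v) (finite_range_toLocal_of_isOpen_ker_onPath ρ hker v)⟩

/-- **Inverse Satake dictionary for the dual transport** (copy of the tree lemma
`hasFrobCharpolyAt_satakePolynomial_of_lAdicDualTransport`). [cite: BuzzardGeeLMS2014, §2.1 and Rem. 3.2.5] -/
private theorem hasFrobCharpolyAt_satakePolynomial_of_lAdicDualTransport_onPath {σ : FramedArtinRep K n}
    {ι : PadicAlgCl ℓ ≃+* ℂ} {ρ₀ : FramedGaloisRep K (PadicAlgCl ℓ) n}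
    (hρ₀ : ∀ g : absoluteGaloisGroup K,
      ((ρ₀ g : GL (Fin n) (PadicAlgCl ℓ)) : Matrix (Fin n) (Fin n) (PadicAlgCl ℓ)) =
        ((((σ g)⁻¹ : GL (Fin n) ℂ) : Matrix (Fin n) (Fin n) ℂ)ᵀ).map (ι.symm : ℂ → PadicAlgCl ℓ))
    {v : HeightOneSpectrum (𝓞 K)} {α : Multiset ℂ}
    (h : ρ₀.HasFrobCharpolyAt v (arithFrobPolyOfSatake ι v.residueCard 1 α)) :
    σ.HasFrobCharpolyAt v (satakePolynomial α) := by
  intro 𝔓 h𝔓 g hg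
  have h0 := h 𝔓 h𝔓 g hg
  unfold FramedRep.charpoly at h0 ⊢
  rw [hρ₀ g] at h0
  set M : Matrix (Fin n) (Fin n) ℂ := (((σ g)⁻¹ : GL (Fin n) ℂ) : Matrix (Fin n) (Fin n) ℂ) with hM
  have e1 : (Mᵀ).map (ι.symm : ℂ → PadicAlgCl ℓ) =
      (Mᵀ).map (((ι.symm : ℂ ≃+* PadicAlgCl ℓ) : ℂ →+* PadicAlgCl ℓ) : ℂ → PadicAlgCl ℓ) := rfl
  rw [e1, Matrix.charpoly_map, Matrix.charpoly_transpose, arithFrobPolyOfSatake_one] at h0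
  have h1 : M.charpoly = (α.map fun a => X - C a⁻¹).prod := by
    apply Polynomial.map_injective ((ι.symm : ℂ ≃+* PadicAlgCl ℓ) : ℂ →+* PadicAlgCl ℓ)
      (ι.symm : ℂ ≃+* PadicAlgCl ℓ).injective
    rw [h0, IrreducibleOffSector.map_multisetProd_X_sub_C]
    rfl
  have hunit : IsUnit M := Units.isUnit _
  have h2 : M⁻¹.charpoly = ((α.map fun a => a⁻¹).map fun c => X - C c⁻¹).prod :=
    IrreducibleOffSector.charpoly_inv_eq_prod_of_charpoly_eq_prod hunit
      (by rw [h1, Multiset.map_map]; rfl)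
  have h3 : ((σ g : GL (Fin n) ℂ) : Matrix (Fin n) (Fin n) ℂ) = M⁻¹ := by
    rw [hM, ← Matrix.coe_units_inv, inv_inv]
  rw [h3, h2, Multiset.map_map]
  unfold satakePolynomial
  refine congrArg Multiset.prod (Multiset.map_congr rfl fun a _ => ?_)
  simp only [Function.comp_apply, inv_inv]

omit [NumberField K] in
/-- Unramifiedness passes back along the dual transport (kernel dictionary). [folklore] -/
private theorem isUnramifiedAt_of_lAdicDualTransport_onPath {σ : FramedArtinRep K n}
    {ρ₀ : FramedGaloisRep K (PadicAlgCl ℓ) n}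
    (hker : ∀ g : absoluteGaloisGroup K, ρ₀ g = 1 ↔ σ g = 1) {v : HeightOneSpectrum (𝓞 K)}
    (h : ρ₀.IsUnramifiedAt v) : σ.IsUnramifiedAt v :=
  fun 𝔓 h𝔓 τ hτ => (hker τ).mp (h 𝔓 h𝔓 τ hτ)

/-- From the summit's a.e. Satake clause on the dual transport to Tunnell's `π = π(σ)` (copy of the tree
lemma `isPiOfArtinRep_of_eventually_satakeFrobCompatibleAt_lAdicDualTransport`). [cite: Tunnell1981, p. 173]
[cite: BuzzardGeeLMS2014, Conj. 3.2.1 and Rem. 3.2.5] -/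
private theorem isPiOfArtinRep_of_eventually_satakeFrobCompatibleAt_lAdicDualTransport_onPath
    {hcpt : isCompact_glFiniteIntegralLevel n K} {σ : FramedArtinRep K n}
    {π : AutomorphicRepData (AutomorphyDatum.gl n K hcpt)} {ι : PadicAlgCl ℓ ≃+* ℂ}
    {ρ₀ : FramedGaloisRep K (PadicAlgCl ℓ) n}
    (hρ₀ : ∀ g : absoluteGaloisGroup K,
      ((ρ₀ g : GL (Fin n) (PadicAlgCl ℓ)) : Matrix (Fin n) (Fin n) (PadicAlgCl ℓ)) =
        ((((σ g)⁻¹ : GL (Fin n) ℂ) : Matrix (Fin n) (Fin n) ℂ)ᵀ).map (ι.symm : ℂ → PadicAlgCl ℓ))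
    (hker : ∀ g : absoluteGaloisGroup K, ρ₀ g = 1 ↔ σ g = 1)
    (h : ∀ᶠ v : HeightOneSpectrum (𝓞 K) in cofinite, SatakeFrobCompatibleAt ι π ρ₀ v) :
    IsPiOfArtinRep σ π := by
  filter_upwards [h] with v hv
  obtain ⟨α, hα, hunr, hcp⟩ := hv
  exact ⟨α, hα, isUnramifiedAt_of_lAdicDualTransport_onPath hker hunr,
    hasFrobCharpolyAt_satakePolynomial_of_lAdicDualTransport_onPath hρ₀ hcp⟩

/-- **The typed summit implies the strong Artin conjecture in Tunnell's a.e. sense, every irreducible Artin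
representation, every rank, every number field** (Statement-level copy of the tree theorem
`Summit.Langlands.Langlands.Theorems.strongArtin_of_langlands`, same proof). [cite: FontaineMazurGeometric1995, Conj. 1]
[cite: BuzzardGeeLMS2014, Conj. 3.2.2] [cite: Tunnell1981, p. 173] -/
theorem strongArtin_of_langlands_onPath (hL : _root_.Langlands) {K : Type} [Field K] [NumberField K]
    {n : ℕ} (hn : 0 < n) (σ : FramedArtinRep K n) (hirr : σ.toGaloisRep.IsIrreducible) :
    ∃ (hcpt : isCompact_glFiniteIntegralLevel n K) (π : CuspidalAutomorphicRepData n K hcpt),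
      π.1.IsLAlgebraic ∧ IsPiOfArtinRep σ π.1 := by
  obtain ⟨⟨𝓡⟩, h𝓡⟩ := hL K
  have hcpt : isCompact_glFiniteIntegralLevel n K := isCompact_glFiniteIntegralLevel_holds n K
  obtain ⟨ι⟩ := PadicAlgCl.nonempty_ringEquiv_complex 2
  obtain ⟨ρ₀, hρ₀, hker, hirr₀⟩ := IrreducibleOffSector.exists_lAdicDualTransport σ ι
  have hkerOpen : IsOpen (ρ₀.toMonoidHom.ker : Set (absoluteGaloisGroup K)) := by
    have hset : (ρ₀.toMonoidHom.ker : Set (absoluteGaloisGroup K)) = σ.toMonoidHom.ker := by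
      ext g
      simp only [SetLike.mem_coe, MonoidHom.mem_ker]
      exact hker g
    rw [hset]
    exact FramedArtinRep.isOpen_ker_toMonoidHom σ
  obtain ⟨π, hLalg, hcorr⟩ := (h𝓡 𝓡 n hn hcpt).2 2 ι ρ₀ (hirr₀ hirr)
    (isGeometricFramed_of_isOpen_ker_onPath 𝓡 ρ₀ hkerOpen)
  exact ⟨hcpt, π, hLalg,
    isPiOfArtinRep_of_eventually_satakeFrobCompatibleAt_lAdicDualTransport_onPath hρ₀ hker hcorr.1⟩

end Support

/-! ## 1. The family (same text as the skeleton `Lines/FittingIndexTwoReciprocity.lean`) -/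

/-- `G` has a largest nilpotent normal subgroup, of index `d` (Fitting index `d`). -/
def HasFittingIndex (G : Type*) [Group G] (d : ℕ) : Prop :=
  ∃ N : Subgroup G, N.Normal ∧ Group.IsNilpotent N ∧ N.index = d ∧
    ∀ M : Subgroup G, M.Normal → Group.IsNilpotent M → M ≤ N

/-- The family, member `d`. -/
def FittingIndexReciprocity (d : ℕ) : Prop :=
  ∀ (K : Type) [Field K] [NumberField K] (n : ℕ), 0 < n →
    ∀ σ : FramedArtinRep K n, σ.toGaloisRep.IsIrreducible → HasFittingIndex σ.toMonoidHom.range d →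
      ∃ (hcpt : isCompact_glFiniteIntegralLevel n K) (π : CuspidalAutomorphicRepData n K hcpt),
        IsPiOfArtinRep σ π.1

/-- The rung (`d = 2`). -/
def FittingIndexTwoReciprocity : Prop := FittingIndexReciprocity 2

/-! ## 2. On-path (no sorry anywhere in this file) -/

/-- **On-path**: the summit implies every member of the family. -/
theorem fittingIndexReciprocity_of_langlands (d : ℕ) (hL : _root_.Langlands) : FittingIndexReciprocity d := by
  intro K _ _ n hn σ hirr _hF
  obtain ⟨hcpt, π, -, hπ⟩ := strongArtin_of_langlands_onPath hL hn σ hirr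
  exact ⟨hcpt, π, hπ⟩

/-- **F4 on-path lemma for the rung**: `Langlands → FittingIndexTwoReciprocity`. -/
theorem FittingIndexTwoReciprocity_of_Langlands (hL : _root_.Langlands) : FittingIndexTwoReciprocity :=
  fittingIndexReciprocity_of_langlands 2 hL

end Summit.Langlands.Langlands.Cruxes.ReciprocityUpToIrreducibility.FittingIndexTwoReciprocity.OnPath

end
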